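import Summits.NavierStokesRegularity.FluidComputer.PalasekTowerBurgersCornerCore

/-!
# The Burgers child core at the TUNED rates `(2^24, 33/32, 12/5)`: all four level-1 clauses with MARGIN 6/5 under the ORIGINAL
# register constants (`c₁ = 1`, `c₂ = 5/3`), at the explicit endowment `(C, λ) = (3/2, (49/50)²)`
# (crux `EpisodeBase` 19179; kernel companion V of the holder's RE-TUNING BRIEF v1.2c — item (b) of the PTB planner's word 08:23Z)

Cell `ns-blowup`, seat `ns-palasek-19179-p2` (g5). The planner's decision rule (STATUS 2026-08-27T08:23Z): «recommend RE-BASE at the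
S-N1 verdict iff (a) [the generic G-layer + a definite `TowerRates.tuned`] is in the tree and (b) shows the letter's four faces
simultaneously meetable at `tuned` with margin ≥ 1.2 on paper». This file is (b) IN THE KERNEL, in ecbridge-8 g3's MODEL identification
(child core = `burgersVortex (λA₀) 1 (C·N₁^{β−2})`, p433323) at the rates `(N₀, b, β) = (2^24, 33/32, 12/5)` (the record
`TowerRates.tuned` of `PalasekTowerRegisterGlobalAt.lean`; stated here as HYPOTHESES on `R`, so that this file is definition-free):
Burgers factor `B = N₀^{β/2−b} = 2^{81/20} ∈ (16.56, 16.57)`, and with `C = 3/2`, `√λ = 49/50` (`C√λ·B ∈ (24.34, 24.36)`,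
`Cλ·B² > 394`, `λB²/4 > 65`):

* speed floor WITH MARGIN: some point has swirl `≥ (6/5)·Y₁` (needs `C√λB ≥ (6/5)·500π/79 = 23.86…`);
* ceiling WITH MARGIN: every point has swirl `≤ (5/3)/(6/5)·Y₁ = (25/18)·Y₁` (needs `C√λB ≤ 4√2π·25/18 = 24.68…`);
* strain floor WITH MARGIN: `‖Du‖ ≥ (6/5)·A₁` on the axis (needs `CλB² ≥ (6/5)·8π = 30.2`);
* core ledger WITH MARGIN: the rim circle of the level-`1` core ball carries `≥ (6/5)·N₁^{β−2}` (`(3/2)(1 − e^{−65}) ≥ 6/5`).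

So at `tuned` the MODEL child core meets speed floor, ceiling, strain floor and core ledger SIMULTANEOUSLY with margin `6/5` each,
under the register's ORIGINAL constants (`c₁ = 1`, `c₂ = 5/3`; and `θc₂ = 2 < F = 2^{21/20}`, `tuned_sep`). LABEL: E–C / MODEL register
arithmetic (KERNEL). WHAT THIS IS NOT: not Navier–Stokes evidence — an exact infinite-energy profile against the letter; no stage, no
claim about `EpisodeBase` or about any re-based item (none exists; D-0014).

References: P. G. Saffman, *Vortex Dynamics* (CUP 1992) §13.1 (3)–(4) [cite: Saffman1992, §13.1 eq. (4)]; S. Palasek, arXiv:2605.13827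
§3 (3.2) [cite: Palasek2026ElementaryModel, §3 (3.2)].
-/

noncomputable section

namespace Summit.NavierStokesRegularity.FluidComputer.PalasekTowerClayBridge

open Real Set Metric
open Literature.Analysis.FluidPDE

section Tuned

variable (R : TowerRates) (hN : R.N₀ = 2 ^ 24) (hb : R.b = 33 / 32) (hβ : R.β = 12 / 5)
include hN hb hβ

/-- At `(2^24, 33/32, 12/5)`: `B = N₀^{β/2−b} = 2^{81/20}` (`24 · 27/160`). [folklore] -/
theorem palasekTowerBreakdown_burgersTuned_factor_eq : R.N 0 ^ (R.β / 2 - R.b) = (2 : ℝ) ^ ((81 : ℝ) / 20) := by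
  rw [R.N_zero_eq_N₀, hN, hb, hβ, show ((2 : ℝ) ^ 24 : ℝ) = (2 : ℝ) ^ (24 : ℝ) by norm_num, ← Real.rpow_mul (by norm_num)]
  norm_num

/-- … `∈ (16.56, 16.57)`. [folklore] -/
theorem palasekTowerBreakdown_burgersTuned_factor_bounds :
    16.56 < R.N 0 ^ (R.β / 2 - R.b) ∧ R.N 0 ^ (R.β / 2 - R.b) < 16.57 := by
  rw [palasekTowerBreakdown_burgersTuned_factor_eq R hN hb hβ]
  exact ⟨TowerRates.lt_two_rpow_of_pow_lt (a := 81) (m := 1) (r := 20) (by norm_num) (by norm_num),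
    TowerRates.two_rpow_lt_of_pow_lt (by norm_num) (a := 81) (m := 1) (r := 20) (by norm_num) (by norm_num)⟩

/-- At `(2^24, 33/32, 12/5)`: `N₀^{β−2b} = B² > 274`. [folklore] -/
theorem palasekTowerBreakdown_burgersTuned_factor_sq_gt : (274 : ℝ) < R.N 0 ^ (R.β - 2 * R.b) := by
  rw [← R.burgersFactor_sq]
  have h := (palasekTowerBreakdown_burgersTuned_factor_bounds R hN hb hβ).1
  nlinarith

/-- **SPEED FLOOR WITH MARGIN 6/5 at `tuned`**: the child core `burgersVortexSwirl ((49/50)²·A₀) 1 ((3/2)·N₁^{β−2})` reaches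
`(6/5)·Y₁` somewhere. [cite: Saffman1992, §13.1 eq. (4)] -/
theorem palasekTowerBreakdown_burgersTuned_floor_margin :
    ∃ x : EuclideanSpace ℝ (Fin 3),
      6 / 5 * R.Y (0 + 1) ≤ ‖burgersVortexSwirl ((49 / 50) ^ 2 * R.A 0) 1 (3 / 2 * R.N (0 + 1) ^ (R.β - 2)) x‖ := by
  refine palasekTowerBreakdown_burgers_floor R 0 (by norm_num) (by positivity) ?_
  rw [Real.sqrt_sq (by norm_num)]
  have hB := (palasekTowerBreakdown_burgersTuned_factor_bounds R hN hb hβ).1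
  have hπ := Real.pi_lt_d2
  nlinarith

/-- **CEILING WITH MARGIN 6/5 at `tuned`**: every point of the same child core has swirl `≤ (25/18)·Y₁ = (5/3)Y₁/(6/5)`.
[cite: Saffman1992, §13.1 eq. (4)] -/
theorem palasekTowerBreakdown_burgersTuned_ceiling_margin (x : EuclideanSpace ℝ (Fin 3)) :
    ‖burgersVortexSwirl ((49 / 50) ^ 2 * R.A 0) 1 (3 / 2 * R.N (0 + 1) ^ (R.β - 2)) x‖ ≤ 25 / 18 * R.Y (0 + 1) := by
  refine palasekTowerBreakdown_burgers_noOvershoot R 0 (by norm_num) (by positivity) ?_ x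
  rw [Real.sqrt_sq (by norm_num)]
  have hB := (palasekTowerBreakdown_burgersTuned_factor_bounds R hN hb hβ).2
  have h4 := four_sqrt_two_pi_gt
  nlinarith

/-- **STRAIN FLOOR WITH MARGIN 6/5 at `tuned`**: the full child field has `‖Du‖ ≥ (6/5)·A₁` on its axis.
[cite: Saffman1992, §13.1 eq. (3)] -/
theorem palasekTowerBreakdown_burgersTuned_strain_margin :
    ∃ x : EuclideanSpace ℝ (Fin 3),
      6 / 5 * R.A (0 + 1) ≤ ‖fderiv ℝ (burgersVortex ((49 / 50) ^ 2 * R.A 0) 1 (3 / 2 * R.N (0 + 1) ^ (R.β - 2))) x‖ := by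
  refine palasekTowerBreakdown_burgers_strainFloor_axis R 0 (by norm_num) (by positivity) ?_
  have hsq := palasekTowerBreakdown_burgersTuned_factor_sq_gt R hN hb hβ
  have h8 := palasekTowerBreakdown_eight_pi_lt
  nlinarith

/-- **CORE LEDGER WITH MARGIN 6/5 at `tuned`**: on the rim circle of the level-`1` core ball the same child core carries circulation
`≥ (6/5)·N₁^{β−2}` (`(3/2)(1 − e^{−λB²/4})`, `λB²/4 > 65`). [cite: Saffman1992, §13.1 eq. (3)] -/
theorem palasekTowerBreakdown_burgersTuned_coreLedger_margin :
    ∃ (x' : EuclideanSpace ℝ (Fin 3)) (γ : ℝ → EuclideanSpace ℝ (Fin 3)),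
      ‖x'‖ ≤ 0 ∧ ContDiff ℝ 1 γ ∧ γ 0 = γ 1 ∧
      (∀ s ∈ Icc (0 : ℝ) 1, γ s ∈ closedBall x' (1 / R.N 1)) ∧
      (∀ s ∈ Icc (0 : ℝ) 1, ‖deriv γ s‖ ≤ 8 * π / R.N 1) ∧
      6 / 5 * R.N 1 ^ (R.β - 2) ≤
        circulation (burgersVortex ((49 / 50) ^ 2 * R.A 0) 1 (3 / 2 * R.N (0 + 1) ^ (R.β - 2))) γ := by
  refine ⟨0, circleLoop (0 : EuclideanSpace ℝ (Fin 3)) (1 / R.N 1) (EuclideanSpace.single (0 : Fin 3) (1 : ℝ))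
      (EuclideanSpace.single (1 : Fin 3) (1 : ℝ)), by simp, contDiff_circleLoop _ _ _ _, ?_,
    fun s _ => rimCircle_mem_closedBall R s, fun s _ => norm_deriv_rimCircle_le R s, ?_⟩
  · have h := periodic_circleLoop (0 : EuclideanSpace ℝ (Fin 3)) (1 / R.N 1) (EuclideanSpace.single (0 : Fin 3) (1 : ℝ))
      (EuclideanSpace.single (1 : Fin 3) (1 : ℝ)) 0
    rw [zero_add] at h
    exact h.symm
  · rw [circulation_burgersChild_rimCircle R (by positivity)]
    have hN1 : 0 < R.N 1 ^ (R.β - 2) := Real.rpow_pos_of_pos (R.N_pos 1) _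
    have hsq := palasekTowerBreakdown_burgersTuned_factor_sq_gt R hN hb hβ
    set x : ℝ := (49 / 50 : ℝ) ^ 2 * R.N 0 ^ (R.β - 2 * R.b) / 4 with hx
    have hx65 : (65 : ℝ) ≤ x := by rw [hx]; nlinarith
    have hexp : Real.exp (-x) ≤ 1 / 5 := by
      have h := Real.add_one_le_exp x
      rw [Real.exp_neg, inv_le_comm₀ (Real.exp_pos _) (by norm_num)]
      linarith
    nlinarith

/-- **ALL FOUR WITH MARGIN 6/5 at `tuned`, under the ORIGINAL constants** — the kernel form of item (b) of the planner's word.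
[cite: Saffman1992, §13.1 eq. (4)] -/
theorem palasekTowerBreakdown_burgersTuned_passes_all_margin :
    (∃ x : EuclideanSpace ℝ (Fin 3),
      6 / 5 * R.Y (0 + 1) ≤ ‖burgersVortexSwirl ((49 / 50) ^ 2 * R.A 0) 1 (3 / 2 * R.N (0 + 1) ^ (R.β - 2)) x‖) ∧
    (∀ x : EuclideanSpace ℝ (Fin 3),
      ‖burgersVortexSwirl ((49 / 50) ^ 2 * R.A 0) 1 (3 / 2 * R.N (0 + 1) ^ (R.β - 2)) x‖ ≤ 25 / 18 * R.Y (0 + 1)) ∧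
    (∃ x : EuclideanSpace ℝ (Fin 3),
      6 / 5 * R.A (0 + 1) ≤ ‖fderiv ℝ (burgersVortex ((49 / 50) ^ 2 * R.A 0) 1 (3 / 2 * R.N (0 + 1) ^ (R.β - 2))) x‖) ∧
    (∃ (x' : EuclideanSpace ℝ (Fin 3)) (γ : ℝ → EuclideanSpace ℝ (Fin 3)),
      ‖x'‖ ≤ 0 ∧ ContDiff ℝ 1 γ ∧ γ 0 = γ 1 ∧
      (∀ s ∈ Icc (0 : ℝ) 1, γ s ∈ closedBall x' (1 / R.N 1)) ∧
      (∀ s ∈ Icc (0 : ℝ) 1, ‖deriv γ s‖ ≤ 8 * π / R.N 1) ∧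
      6 / 5 * R.N 1 ^ (R.β - 2) ≤
        circulation (burgersVortex ((49 / 50) ^ 2 * R.A 0) 1 (3 / 2 * R.N (0 + 1) ^ (R.β - 2))) γ) :=
  ⟨palasekTowerBreakdown_burgersTuned_floor_margin R hN hb hβ, palasekTowerBreakdown_burgersTuned_ceiling_margin R hN hb hβ,
    palasekTowerBreakdown_burgersTuned_strain_margin R hN hb hβ, palasekTowerBreakdown_burgersTuned_coreLedger_margin R hN hb hβ⟩

end Tuned

end Summit.NavierStokesRegularity.FluidComputer.PalasekTowerClayBridge

end
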